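import Summits.ResolutionOfSingularities.ResolutionOfSingularities.Theorems.MarkedTransferCampaignW46ThreefoldsGammaFreeGlobalIntersectionBlowup
import HarnessLib

/-!
# [OURS · L1 W4.6 rung (ii) ladder support] STRICT TRANSFORMS OF BRANCHES UNDER THE POINT BLOW-UP OF A REGULAR SURFACE, II:
# THE POINT OF A REGULAR BRANCH EXISTS AND IS UNIQUE (brick for the `d = 2` rung (ii-2), design point (3) of the holder's
# RUNG-II-2-PLAN, wish-list item (I4) «the strict transform of a regular branch meets E in exactly one point»)

Cell res-hironaka, LADDER-RESOLUTION rung L (D-0089), slot W4.6, rung (ii); seat res-L1-s46-pv-10 = res-D-pv-047, filed as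
SUPPORT for the `d = 2` rung (holder res-L1-s46-pv-11 = res-D-pv-049, GO 2026-08-27T05:30:58Z). Host route MarkedTransfer,
host item `HypersurfaceOrderReductionDimLeThree` (stmt-ResolutionOfSingularities-16156), `--kind proof --supports … --as helper`.
Sequel of `…GammaFreeGlobalIntersection.lean` (p504615) and `…GammaFreeGlobalIntersectionBlowup.lean` (p505558); same
setting and vocabulary (quadratic transforms `R₁` of the two-dimensional regular local ring `R ⊆ K = Frac R`, chart
elements `x` with `R[𝔪/x] ⊆ R₁`, strict transform `f/x` of a regular branch `f ∈ 𝔪 ∖ 𝔪²`; "passes through `R₁`" =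
`f/x ∈ 𝔪_{R₁}` = `x/f ∉ R₁`). Classical (Zariski; Huneke–Swanson §14.2; Hartshorne V Cor. 3.7 with `r = 1`); nothing is a
statement of the manuscript under adjudication; no typed `Hironaka2017` candidate and no unproved named fact enters.
DEF-FREE. AI-written; weaker than expert review.

## What is proved

* `maximalIdeal_eq_span_pair_of_regular_of_div_mem_maximalIdeal` — **if the strict transform of a REGULAR branch `f`
  passes through a point `R₁` of the chart `R[𝔪/x]`, then `𝔪 = (x, f)`** (every chart element at such a point is
  transversal to `f`), so the `𝔪 = (x, f)` hypothesis of part I is automatic there.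
* `eq_of_div_mem_maximalIdeal` (same chart), `eq_of_regular_of_div_mem_maximalIdeal` (any charts) — **UNIQUENESS: two
  quadratic transforms through which the strict transform of `f` passes are equal** (both are `R[f/x]_{(x, f/x)}`).
* `exists_isQuadraticTransform_div_mem` — **EXISTENCE: for `𝔪 = (x, f)` there is a two-dimensional quadratic transform
  `R₁ ⊇ R[𝔪/x]` with `f/x ∈ R₁`, `x/f ∉ R₁`** (the ideal `(x, f/x)` of `R[f/x]` is proper — a relation
  `1 = α x + β f/x` would put `1 ∈ (x, f)` by the tree's `coeff_mem_span_pair_of_aeval_eq_zero` — so it lies in a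
  maximal `M`; `R₁ = R[f/x]_M` is a quadratic transform dominating `R`, of dimension `2` because `f/x ∉ x R[f/x]`
  by the order count `ord(xⁿ f) = n + 1`).
* `existsUnique_point_of_regular` — the two combined, instance-free: **the strict transform of a regular branch meets the
  exceptional curve in exactly one closed point.**

Separation of transversal branches and M. Noether's drop `i₁ + 1 = i` are in part III
`…GammaFreeGlobalIntersectionNoetherDrop.lean`.

References: C. Huneke, I. Swanson, *Integral Closure of Ideals, Rings, and Modules* (2006), §14.2 (p. 264) [HunekeSwanson2006];
R. Hartshorne, *Algebraic Geometry* (1977), Ch. V Prop. 3.6, Cor. 3.7 [Hartshorne1977]; O. Zariski, P. Samuel, *Commutative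
Algebra* II (1960), App. 5 [ZariskiSamuel1960]; tree `Resolution/QuadraticTransforms{,Chart,Structure,Factorization,KeyLemma}`,
`Resolution/QuadraticTransformWeakTransform` (`exists_pow_mul_eq_chartIncl`), `Resolution/RegularLocalOrder`
(`mul_not_mem_pow_of_not_mem_pow`). H. Hironaka, ms. 2017-03-23 — scope only, under adjudication, not cited as fact.
[Hironaka2017]
-/

noncomputable section

set_option linter.dupNamespace false

open IsLocalRing Polynomial

namespace Summit.ResolutionOfSingularities.ResolutionOfSingularities.Theorems

namespace CampaignW46

open Literature.AlgebraicGeometry.Resolution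

universe u

variable {K : Type u} [Field K] {R R₁ R₂ : Subring K} [IsRegularLocalRing R]

/-! ## At a point of the strict transform of a regular branch, every chart element is transversal -/

section Transversal

/-- **If the strict transform of a REGULAR branch `f` passes through a point `R₁` of the chart
`R[𝔪/x]`, then `x` is transversal to `f`: `𝔪 = (x, f)`.** (With `𝔪 = (x, y)`, `f = a x + b y`;
if `b ∈ 𝔪` then `b · y/x ∈ 𝔪_{R₁}`, so `a ∈ 𝔪_{R₁} ∩ R = 𝔪` and `f ∈ 𝔪²`.) So the hypothesis
`𝔪 = (x, f)` of the neighbouring theorems is automatic at such a point. [folklore] -/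
theorem maximalIdeal_eq_span_pair_of_regular_of_div_mem_maximalIdeal [IsLocalRing R₁]
    (h₁ : IsQuadraticTransform R R₁) (hdim : ringKrullDim R = 2) {x f : R}
    (hx : x ∈ maximalIdeal R) (hx0 : x ≠ 0) (hA : blowupRing R (x : K) ≤ R₁)
    (hf : f ∈ maximalIdeal R) (hf2 : f ∉ maximalIdeal R ^ 2)
    {hfx : ((f : R) : K) / x ∈ R₁} (hu : (⟨_, hfx⟩ : R₁) ∈ maximalIdeal R₁) :
    maximalIdeal R = Ideal.span {x, f} := by
  have hx0K : ((x : R) : K) ≠ 0 := fun e => hx0 (Subtype.ext e)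
  have hx2 : x ∉ maximalIdeal R ^ 2 := IsQuadraticTransform.chart_not_mem_sq hA h₁.dominates hx0
  obtain ⟨y, hm, -, -⟩ := exists_maximalIdeal_eq_span_pair_of_not_mem_sq hdim hx hx2
  have hym : y ∈ maximalIdeal R := hm ▸ Ideal.subset_span (by simp)
  have hf' := hf
  rw [hm, Ideal.mem_span_pair] at hf'
  obtain ⟨a, b, hab⟩ := hf'
  by_cases hb : b ∈ maximalIdeal R
  · -- then `a ∈ 𝔪` too, and `f ∈ 𝔪²`
    exfalso
    have hyx : ((y : R) : K) / x ∈ R₁ := hA (div_mem_blowupRing _ hym)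
    -- `b · (y/x) = (b/x) · y ∈ 𝔪_{R₁}`
    have hby : (⟨(b : K) * (((y : R) : K) / x), R₁.mul_mem (h₁.dominates.1 b.2) hyx⟩ : R₁) ∈
        maximalIdeal R₁ := by
      have e : (⟨(b : K) * (((y : R) : K) / x), R₁.mul_mem (h₁.dominates.1 b.2) hyx⟩ : R₁) =
          ⟨((b : R) : K) / x, hA (div_mem_blowupRing _ hb)⟩ * Subring.inclusion h₁.dominates.1 y :=
        Subtype.ext (by change (b : K) * ((y : K) / x) = (b : K) / x * y; ring)
      rw [e]
      exact Ideal.mul_mem_left _ _ ((incl_mem_maximalIdeal_iff h₁.dominates y).mpr hym)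
    -- `a = f/x - b · y/x`
    have ha : Subring.inclusion h₁.dominates.1 a ∈ maximalIdeal R₁ := by
      have e : Subring.inclusion h₁.dominates.1 a = ⟨_, hfx⟩ -
          ⟨(b : K) * (((y : R) : K) / x), R₁.mul_mem (h₁.dominates.1 b.2) hyx⟩ := Subtype.ext (by
        change ((a : R) : K) = ((f : R) : K) / x - (b : K) * ((y : K) / x)
        rw [← hab, Subring.coe_add, Subring.coe_mul, Subring.coe_mul]
        field_simp
        ring)
      rw [e]
      exact (maximalIdeal R₁).sub_mem hu hby
    have haR : a ∈ maximalIdeal R := (incl_mem_maximalIdeal_iff h₁.dominates a).mp ha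
    apply hf2
    rw [← hab, pow_two]
    exact Ideal.add_mem _ (Ideal.mul_mem_mul haR hx) (Ideal.mul_mem_mul hb hym)
  · -- `b` is a unit: `(x, f) = (x, b y) = (x, y)`
    have hbu : IsUnit b := IsLocalRing.notMem_maximalIdeal.mp hb
    rw [hm]
    apply le_antisymm
    · -- `y = b⁻¹ (f - a x)`
      have hy : y ∈ Ideal.span {x, f} := by
        rw [Ideal.mem_span_pair]
        obtain ⟨c, hc⟩ := hbu.exists_left_inv
        exact ⟨-(c * a), c, by linear_combination (-c) * hab + y * hc⟩
      rw [Ideal.span_le]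
      rintro z (rfl | rfl)
      · exact Ideal.subset_span (by simp)
      · exact hy
    · rw [Ideal.span_le]
      rintro z (rfl | rfl)
      · exact Ideal.subset_span (by simp)
      · rw [SetLike.mem_coe, ← hab]
        exact Ideal.add_mem _ (Ideal.mul_mem_left _ _ (Ideal.subset_span (by simp)))
          (Ideal.mul_mem_left _ _ (Ideal.subset_span (by simp)))


end Transversal

/-! ## The point of a regular branch is unique, and it exists -/

section Unique

/-- **Uniqueness of the point of a regular branch.** With `𝔪 = (x, f)`: two quadratic transforms of
`R` in which the strict transform `f/x` of `f` is a non-unit coincide (both are the local ring of the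
chart `R[f/x]` at its maximal ideal `(x, f/x)`). [cite: Hartshorne1977, Ch. V Cor. 3.7 (r = 1)] -/
theorem eq_of_div_mem_maximalIdeal [IsLocalRing R₁] [IsLocalRing R₂]
    (h₁ : IsQuadraticTransform R R₁) (h₂ : IsQuadraticTransform R R₂) (hdim : ringKrullDim R = 2)
    {x f : R} (hm : maximalIdeal R = Ideal.span {x, f})
    {hfx₁ : ((f : R) : K) / x ∈ R₁} (hu₁ : (⟨_, hfx₁⟩ : R₁) ∈ maximalIdeal R₁)
    {hfx₂ : ((f : R) : K) / x ∈ R₂} (hu₂ : (⟨_, hfx₂⟩ : R₂) ∈ maximalIdeal R₂) : R₁ = R₂ := by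
  have hx : x ∈ maximalIdeal R := hm ▸ Ideal.subset_span (by simp)
  have hx0 : x ≠ 0 := by
    rintro rfl; exact not_mem_sq_of_span_pair hdim hm (Ideal.zero_mem _)
  have hAeq : blowupRing R (x : K) = chartAdjoin x f := blowupRing_eq_adjoin hm
  have hA₁ : chartAdjoin (K := K) x f ≤ R₁ :=
    hAeq ▸ blowupRing_le_of_div_mem_maximalIdeal h₁ hdim hm hu₁
  have hA₂ : chartAdjoin (K := K) x f ≤ R₂ :=
    hAeq ▸ blowupRing_le_of_div_mem_maximalIdeal h₂ hdim hm hu₂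
  have e₁ := h₁.eq_ofPrime_of_le hx hx0 hAeq.le hA₁
  have e₂ := h₂.eq_ofPrime_of_le hx hx0 hAeq.le hA₂
  have hQ₁ := comap_maximalIdeal_eq_span_pair h₁ hm hx0 hA₁ hu₁
  have hQ₂ := comap_maximalIdeal_eq_span_pair h₂ hm hx0 hA₂ hu₂
  -- both are `A_{(x, f/x)}`
  have key : ∀ z : K, z ∈ R₁ ↔ z ∈ R₂ := by
    intro z
    constructor
    · intro hz
      have hz' := e₁ ▸ hz
      obtain ⟨a, s, hs, rfl⟩ := mem_ofPrime_iff.mp hz'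
      rw [hQ₁, ← hQ₂] at hs
      exact e₂ ▸ (mem_ofPrime_iff.mpr ⟨a, s, hs, rfl⟩)
    · intro hz
      have hz' := e₂ ▸ hz
      obtain ⟨a, s, hs, rfl⟩ := mem_ofPrime_iff.mp hz'
      rw [hQ₂, ← hQ₁] at hs
      exact e₁ ▸ (mem_ofPrime_iff.mpr ⟨a, s, hs, rfl⟩)
  exact Subring.ext key

/-- **Uniqueness across charts.** For a REGULAR branch `f`, a quadratic transform `R₁ ⊇ R[𝔪/x₁]` and a
quadratic transform `R₂` containing `f/x₂` for some other `x₂ ∈ 𝔪 ∖ 0`: if `f/x₁ ∈ 𝔪_{R₁}` and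
`f/x₂ ∈ 𝔪_{R₂}` then `R₁ = R₂` — the strict transform of a regular branch meets the exceptional curve in
exactly one point, whatever charts are used to write it. [cite: Hartshorne1977, Ch. V Cor. 3.7 (r = 1)] -/
theorem eq_of_regular_of_div_mem_maximalIdeal [IsLocalRing R₁] [IsLocalRing R₂]
    (h₁ : IsQuadraticTransform R R₁) (h₂ : IsQuadraticTransform R R₂) (hdim : ringKrullDim R = 2)
    {x₁ x₂ f : R} (hx₁ : x₁ ∈ maximalIdeal R) (hx₁0 : x₁ ≠ 0) (hA₁ : blowupRing R (x₁ : K) ≤ R₁)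
    (hx₂ : x₂ ∈ maximalIdeal R) (hx₂0 : x₂ ≠ 0)
    (hf : f ∈ maximalIdeal R) (hf2 : f ∉ maximalIdeal R ^ 2)
    {hfx₁ : ((f : R) : K) / x₁ ∈ R₁} (hu₁ : (⟨_, hfx₁⟩ : R₁) ∈ maximalIdeal R₁)
    {hfx₂ : ((f : R) : K) / x₂ ∈ R₂} (hu₂ : (⟨_, hfx₂⟩ : R₂) ∈ maximalIdeal R₂) : R₁ = R₂ := by
  have hm₁ : maximalIdeal R = Ideal.span {x₁, f} :=
    maximalIdeal_eq_span_pair_of_regular_of_div_mem_maximalIdeal h₁ hdim hx₁ hx₁0 hA₁ hf hf2 hu₁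
  -- `R₂` also lies in the `x₁`-chart and `f/x₁ = (f/x₂)(x₂/x₁) ∈ 𝔪_{R₂}`
  have hx₁0K : ((x₁ : R) : K) ≠ 0 := fun e => hx₁0 (Subtype.ext e)
  have hx₂0K : ((x₂ : R) : K) ≠ 0 := fun e => hx₂0 (Subtype.ext e)
  have hf0 : f ≠ 0 := by rintro rfl; exact hf2 (Ideal.zero_mem _)
  have hA₂' : blowupRing R (x₁ : K) ≤ R₂ := by
    rcases h₂.blowupRing_le_or hm₁ with h | h
    · exact h
    · exact absurd (h (div_mem_blowupRing _ hx₂))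
        ((div_mem_maximalIdeal_iff_not_mem hx₂0 hf0 hfx₂).mp hu₂)
  have h21 : ((x₂ : R) : K) / x₁ ∈ R₂ := hA₂' (div_mem_blowupRing _ hx₂)
  have hfx₁' : ((f : R) : K) / x₁ ∈ R₂ := by
    have e : ((f : R) : K) / x₁ = ((f : R) : K) / x₂ * (((x₂ : R) : K) / x₁) := by field_simp
    rw [e]; exact R₂.mul_mem hfx₂ h21
  have hu₂' : (⟨_, hfx₁'⟩ : R₂) ∈ maximalIdeal R₂ := by
    have e : (⟨_, hfx₁'⟩ : R₂) = ⟨_, hfx₂⟩ * ⟨_, h21⟩ := Subtype.ext (by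
      change ((f : R) : K) / x₁ = ((f : R) : K) / x₂ * (((x₂ : R) : K) / x₁); field_simp)
    rw [e]; exact Ideal.mul_mem_right _ _ hu₂
  exact eq_of_div_mem_maximalIdeal h₁ h₂ hdim hm₁ hu₁ hu₂'

/-- **Existence of the point of a regular branch.** With `𝔪 = (x, f)` in the two-dimensional regular
local ring `R` of `K`: there is a two-dimensional quadratic transform `R₁ ⊇ R[𝔪/x]` of `R` through which
the strict transform of `f` passes: `f/x ∈ R₁` and `x/f ∉ R₁` (`R₁ = R[f/x]_{(x, f/x)}`; the ideal
`(x, f/x)` of `R[f/x]` is proper because a relation `1 = α x + β f/x` would put `1 ∈ (x, f) = 𝔪`, by the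
tree's `coeff_mem_span_pair_of_aeval_eq_zero`). [cite: HunekeSwanson2006, §14.2 (p. 264)] -/
theorem exists_isQuadraticTransform_div_mem (hdim : ringKrullDim R = 2)
    {x f : R} (hm : maximalIdeal R = Ideal.span {x, f}) :
    ∃ R₁ : Subring K, IsQuadraticTransform R R₁ ∧ ringKrullDim R₁ = 2 ∧
      blowupRing R (x : K) ≤ R₁ ∧ ((f : R) : K) / x ∈ R₁ ∧ ((x : R) : K) / f ∉ R₁ := by
  have hx : x ∈ maximalIdeal R := hm ▸ Ideal.subset_span (by simp)
  have hf : f ∈ maximalIdeal R := hm ▸ Ideal.subset_span (by simp)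
  have hx2 : x ∉ maximalIdeal R ^ 2 := not_mem_sq_of_span_pair hdim hm
  have hf2 : f ∉ maximalIdeal R ^ 2 := not_mem_sq_of_span_pair' hdim hm
  have hx0 : x ≠ 0 := by rintro rfl; exact hx2 (Ideal.zero_mem _)
  have hf0 : f ≠ 0 := by rintro rfl; exact hf2 (Ideal.zero_mem _)
  have hx0K : ((x : R) : K) ≠ 0 := fun e => hx0 (Subtype.ext e)
  have hf0K : ((f : R) : K) ≠ 0 := fun e => hf0 (Subtype.ext e)
  have hxp : Prime x := IsRegularLocalRing.prime_of_not_mem_sq hx hx2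
  have hxf : ¬ x ∣ f := by
    rintro ⟨c, rfl⟩
    apply maximalIdeal_ne_span_singleton hdim x
    rw [hm]
    refine le_antisymm ?_ (Ideal.span_mono (by simp))
    rw [Ideal.span_le]
    rintro z (rfl | rfl)
    · exact Ideal.mem_span_singleton_self _
    · exact Ideal.mem_span_singleton'.mpr ⟨c, mul_comm c _⟩
  have hpq : ∀ t, x ∣ f * t → x ∣ t := fun t ht => (hxp.dvd_or_dvd ht).resolve_left hxf
  -- the chart `A = R[f/x]`, its element `u = f/x`, the ideal `Q₀ = (x, u)`
  set u : K := ((f : R) : K) / ((x : R) : K) with hudef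
  set A : Subring K := chartAdjoin (K := K) x f with hAdef
  have hAeq : blowupRing R (x : K) = A := blowupRing_eq_adjoin hm
  set ιA : R →+* A := chartIncl (K := K) x f with hιA
  set uA : A := ⟨u, Algebra.self_mem_adjoin_singleton R u⟩ with huA
  haveI : IsNoetherianRing A := isNoetherianRing_adjoin_toSubring R u
  set Q₀ : Ideal A := Ideal.span {ιA x, uA} with hQ₀
  -- `Q₀` is a proper ideal: a relation `α x + β u = 1` in `A` would give `1 ∈ (x, f) = 𝔪`
  have hQ₀top : Q₀ ≠ ⊤ := by
    intro htop
    have h1 : (1 : A) ∈ Q₀ := htop ▸ Submodule.mem_top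
    rw [hQ₀, Ideal.mem_span_pair] at h1
    obtain ⟨α, β, hαβ⟩ := h1
    obtain ⟨Gα, hGα⟩ := exists_aeval_eq_of_mem_adjoin α.2
    obtain ⟨Gβ, hGβ⟩ := exists_aeval_eq_of_mem_adjoin β.2
    have e : (α : K) * ((x : R) : K) + (β : K) * u = 1 := by
      have := congrArg (fun t : A => (t : K)) hαβ
      simpa [hιA, huA] using this
    set F : (↥R)[X] := C 1 - C x * Gα - X * Gβ with hF
    have hF0 : aeval u F = 0 := by
      rw [hF, map_sub, map_sub, map_mul, map_mul, aeval_C, aeval_C, aeval_X, map_one, hudef, hGα, hGβ,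
        Algebra.algebraMap_ofSubsemiring_apply]
      rw [hudef] at e
      linear_combination (-1 : K) * e
    have hc := coeff_mem_span_pair_of_aeval_eq_zero hx0 hpq hF0 0
    have hcoeff : F.coeff 0 = 1 - x * Gα.coeff 0 := by
      rw [hF, coeff_sub, coeff_sub, coeff_C_zero, coeff_C_mul, mul_coeff_zero, coeff_X_zero,
        zero_mul, sub_zero]
    rw [hcoeff, ← hm] at hc
    have h1m : (1 : R) ∈ maximalIdeal R := by
      have := (maximalIdeal R).add_mem hc (Ideal.mul_mem_right (Gα.coeff 0) _ hx)
      rwa [sub_add_cancel] at this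
    exact (maximalIdeal.isMaximal R).ne_top ((Ideal.eq_top_iff_one _).mpr h1m)
  obtain ⟨M, hM, hQM⟩ := Ideal.exists_le_maximal Q₀ hQ₀top
  haveI : M.IsPrime := hM.isPrime
  set R₁ : Subring K := (LocalSubring.ofPrime A M).toSubring with hR₁
  haveI : IsNoetherianRing R₁ := isNoetherianRing_ofPrime (A := A) (P := M)
  have hAR₁ : A ≤ R₁ := LocalSubring.le_ofPrime A M
  have hxQ₀ : ιA x ∈ Q₀ := Ideal.subset_span (by simp)
  have hxM : ιA x ∈ M := hQM hxQ₀
  have huM : uA ∈ M := hQM (Ideal.subset_span (by simp))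
  have hmemmax : ∀ a : A, a ∈ M → algebraMap A R₁ a ∈ maximalIdeal R₁ := fun a ha =>
    (IsLocalization.AtPrime.to_map_mem_maximal_iff R₁ M a).mpr ha
  -- the exceptional prime `𝔭 = 𝔪 A = x A ⊆ Q₀ ⊆ M`
  set 𝔭 : Ideal A := (maximalIdeal R).map ιA with h𝔭def
  haveI h𝔭 : 𝔭.IsPrime := isPrime_map_incl (K := K) hx0 hpq hx hf
  have h𝔭eq : 𝔭 = Ideal.span {ιA x} := map_maximalIdeal_chartIncl hm hx0
  have h𝔭Q₀ : 𝔭 ≤ Q₀ := by rw [h𝔭eq, Ideal.span_singleton_le_iff_mem]; exact hxQ₀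
  have h𝔭M : 𝔭 ≤ M := h𝔭Q₀.trans hQM
  -- `R₁` dominates `R`
  have hdom : SubringDominates R R₁ := by
    refine ⟨(subring_le_adjoin R u).trans hAR₁, fun r hr hrinv => ?_⟩
    by_cases hr0 : r = 0
    · rw [hr0, inv_zero]; exact R.zero_mem
    by_contra hnot
    have hrm : (⟨r, hr⟩ : R) ∈ maximalIdeal R :=
      (mem_maximalIdeal_iff_inv_not_mem _).mpr (Or.inr hnot)
    have h1 : algebraMap A R₁ (ιA ⟨r, hr⟩) ∈ maximalIdeal R₁ :=
      hmemmax _ (h𝔭M (Ideal.mem_map_of_mem _ hrm))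
    exact not_mem_maximalIdeal_of_inv_mem (S := R₁) (z := algebraMap A R₁ (ιA ⟨r, hr⟩))
      (by exact hr0) (by exact hrinv) h1
  -- `R₁` is a quadratic transform of `R`
  have hqt : IsQuadraticTransform R R₁ := by
    refine ⟨inferInstance, x, hx, hx0, inferInstance, hAeq ▸ hAR₁, fun z hz => ?_, hdom⟩
    obtain ⟨a, s, hs, rfl⟩ := mem_ofPrime_iff.mp hz
    exact ⟨a, by rw [hAeq]; exact a.2, s, by rw [hAeq]; exact s.2, inv_mem_ofPrime hs, rfl⟩
  -- `u ∈ 𝔪_{R₁}`, i.e. `x/f ∉ R₁`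
  have huR₁ : u ∈ R₁ := hAR₁ uA.2
  have hxfR₁ : ((x : R) : K) / f ∉ R₁ := by
    rw [← div_mem_maximalIdeal_iff_not_mem hx0 hf0 huR₁]
    exact hmemmax uA huM
  -- `uA ∉ 𝔭 = xA` (orders: `u = c x` would give `xⁿ f = x² b` with `b ∈ 𝔪ⁿ`), so `𝔭 < M`
  have hu𝔭 : uA ∉ 𝔭 := by
    rw [h𝔭eq, Ideal.mem_span_singleton']
    rintro ⟨c, hc⟩
    obtain ⟨n, b, hb, hbc⟩ := exists_pow_mul_eq_chartIncl hm hx0 c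
    have hcK : (c : K) * ((x : R) : K) = u := by
      have := congrArg (fun t : A => (t : K)) hc; simpa [hιA, huA] using this
    have hbK : ((b : R) : K) = ((x : R) : K) ^ n * (c : K) := by
      have := congrArg (fun t : A => (t : K)) hbc; simpa [hιA] using this
    have heq : x ^ n * f = x ^ 2 * b := Subtype.ext (by
      change ((x : R) : K) ^ n * (f : K) = ((x : R) : K) ^ 2 * (b : K)
      have ef : ((f : R) : K) = (c : K) * (x : K) * (x : K) := by
        rw [hcK, hudef]; field_simp
      rw [hbK, ef]; ring)
    have hmem : x ^ n * f ∈ maximalIdeal R ^ (n * 1 + 1 + 1) := by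
      rw [heq, show n * 1 + 1 + 1 = 2 + n by ring, pow_add]
      exact Ideal.mul_mem_mul (Ideal.pow_mem_pow hx 2) hb
    exact mul_not_mem_pow_of_not_mem_pow
      (pow_not_mem_pow_of_not_mem_pow (hx2 : x ∉ maximalIdeal R ^ (1 + 1)) n)
      (hf2 : f ∉ maximalIdeal R ^ (1 + 1)) hmem
  have h𝔭neM : 𝔭 ≠ M := fun h => hu𝔭 (h ▸ huM)
  have h𝔭lt : 𝔭 < M := lt_of_le_of_ne h𝔭M h𝔭neM
  have hbot : (⊥ : Ideal A) < 𝔭 := by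
    rw [bot_lt_iff_ne_bot, h𝔭eq, Ne, Ideal.span_singleton_eq_bot]
    intro h
    exact hx0K (congrArg (fun s : A => (s : K)) h)
  -- `dim R₁ = height M = 2`
  have hheight : (2 : ℕ∞) ≤ M.height := by
    have h1 := Ideal.height_add_one_le_of_lt_of_isPrime hbot
    have h2 := Ideal.height_add_one_le_of_lt_of_isPrime h𝔭lt
    rw [Ideal.height_bot, zero_add] at h1
    calc (2 : ℕ∞) = 1 + 1 := by norm_num
      _ ≤ 𝔭.height + 1 := by gcongr
      _ ≤ M.height := h2
  have hdimge : (2 : WithBot ℕ∞) ≤ ringKrullDim R₁ := by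
    rw [IsLocalization.AtPrime.ringKrullDim_eq_height M R₁]
    exact WithBot.coe_le_coe.mpr hheight
  obtain ⟨g, hMg⟩ := exists_eq_span_pair_of_map_maximalIdeal_le hm hx0 rfl h𝔭M
  have hmax : maximalIdeal R₁ = Ideal.span {algebraMap A R₁ (ιA x), algebraMap A R₁ g} := by
    have e : M.map (algebraMap A R₁) = (Ideal.span {ιA x, g}).map (algebraMap A R₁) :=
      congrArg (Ideal.map (algebraMap A R₁)) hMg
    rw [← IsLocalization.AtPrime.map_eq_maximalIdeal M R₁, e, Ideal.map_span,
      Set.image_insert_eq, Set.image_singleton]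
  have hfr : (maximalIdeal R₁).spanFinrank ≤ 2 := by
    rw [hmax]
    refine (Submodule.spanFinrank_span_le_ncard_of_finite (Set.toFinite _)).trans ?_
    exact (Set.ncard_insert_le _ _).trans (by rw [Set.ncard_singleton])
  have hreg : IsRegularLocalRing R₁ :=
    IsRegularLocalRing.of_spanFinrank_maximalIdeal_le _ (le_trans (by exact_mod_cast hfr) hdimge)
  have hd₁ : ringKrullDim R₁ = 2 := by
    refine le_antisymm ?_ hdimge
    rw [← hreg.spanFinrank_maximalIdeal]
    exact_mod_cast hfr
  exact ⟨R₁, hqt, hd₁, hAeq ▸ hAR₁, huR₁, hxfR₁⟩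

/-- **(I4), any chart: existence and uniqueness of the point of a regular branch.** For a regular branch
`f ∈ 𝔪 ∖ 𝔪²` of the two-dimensional regular local ring `R ⊆ K = Frac R` there is a two-dimensional quadratic
transform `R₁` of `R` with a chart element `x` such that `f/x ∈ R₁` is a non-unit (`x/f ∉ R₁`); and any
quadratic transform `R₂` with an element `x₂ ∈ 𝔪 ∖ 0` such that `f/x₂ ∈ R₂` is a non-unit equals `R₁`.
[cite: Hartshorne1977, Ch. V Cor. 3.7 (r = 1)] -/
theorem existsUnique_point_of_regular (hdim : ringKrullDim R = 2) {f : R}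
    (hf : f ∈ maximalIdeal R) (hf2 : f ∉ maximalIdeal R ^ 2) :
    ∃ (R₁ : Subring K) (x : R), IsQuadraticTransform R R₁ ∧ ringKrullDim R₁ = 2 ∧
      x ∈ maximalIdeal R ∧ x ≠ 0 ∧ blowupRing R (x : K) ≤ R₁ ∧
      ((f : R) : K) / x ∈ R₁ ∧ ((x : R) : K) / f ∉ R₁ ∧
      ∀ (R₂ : Subring K) (x₂ : R), IsQuadraticTransform R R₂ → x₂ ∈ maximalIdeal R → x₂ ≠ 0 →
        ((f : R) : K) / x₂ ∈ R₂ → ((x₂ : R) : K) / f ∉ R₂ → R₂ = R₁ := by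
  have hf0 : f ≠ 0 := by rintro rfl; exact hf2 (Ideal.zero_mem _)
  obtain ⟨y, hm', -, -⟩ := exists_maximalIdeal_eq_span_pair_of_not_mem_sq hdim hf hf2
  have hm : maximalIdeal R = Ideal.span {y, f} := hm'.trans Ideal.span_pair_comm
  have hy : y ∈ maximalIdeal R := hm ▸ Ideal.subset_span (by simp)
  have hy0 : y ≠ 0 := by
    rintro rfl; exact not_mem_sq_of_span_pair hdim hm (Ideal.zero_mem _)
  obtain ⟨R₁, h₁, hd₁, hA, hfy, hyf⟩ := exists_isQuadraticTransform_div_mem hdim hm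
  haveI := h₁.isLocalRing
  refine ⟨R₁, y, h₁, hd₁, hy, hy0, hA, hfy, hyf, fun R₂ x₂ h₂ hx₂ hx₂0 hfx₂ hxf₂ => ?_⟩
  haveI := h₂.isLocalRing
  have hu₁ := (div_mem_maximalIdeal_iff_not_mem hy0 hf0 hfy).mpr hyf
  have hu₂ := (div_mem_maximalIdeal_iff_not_mem hx₂0 hf0 hfx₂).mpr hxf₂
  exact (eq_of_regular_of_div_mem_maximalIdeal h₁ h₂ hdim hy hy0 hA hx₂ hx₂0 hf hf2 hu₁ hu₂).symm


end Unique



end CampaignW46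

end Summit.ResolutionOfSingularities.ResolutionOfSingularities.Theorems

end
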